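import Literature.AlgebraicGeometry.Limits.IdealSheafExtension
import Literature.AlgebraicGeometry.Limits.IdealSheafComap
import Literature.AlgebraicGeometry.Resolution.BlowupsComposition
import Literature.AlgebraicGeometry.Resolution.BlowupsExistence
import HarnessLib

/-!
# Admissible blowing ups: finitely many are dominated by one (Stacks 080N)

Topic: `Literature/AlgebraicGeometry/Resolution`. Stacks, Tag 080K: for an open `U ⊆ X`, a
`U`-admissible blowing up is the blowing up of `X` in a closed subscheme of finite presentation
disjoint from `U`; as in `Stacks081R` (`StrictTransformFlattening.lean`) and
`BlowupsCompositionFiniteType.lean` this is rendered by an ideal sheaf OF FINITE TYPE whose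
support is disjoint from `U` and a blowing up along it in the sense of the universal property
(`IsBlowup`). This file proves

* `fg_ideal_comap_of_le`, `fg_ideal_comap` — the pull-back `f⁻¹𝓚 𝒪_X` (`Scheme.IdealSheafData.comap`)
  of an ideal sheaf of finite type is of finite type (locally `V(𝓚(U) B) ⊆ Spec B` over
  `Spec A ⊇ V(𝓚(U))`, `Literature.AlgebraicGeometry.Limits.ideal_comap_eq_map`);
* `fg_ideal_finsetProd`, `support_finsetProd` — finite products of ideal sheaves of finite type
  are of finite type, with support the union of the supports;
* `IsBlowup.exists_isBlowup_prod_dominating` — **Stacks, Tag 080N**: "Let `X` be a quasi-compact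
  and quasi-separated scheme. Let `U ⊂ X` be a quasi-compact open subscheme. Let `bᵢ : Xᵢ → X`,
  `i = 1, …, n` be `U`-admissible blowups. There exists a `U`-admissible blowup `b : X' → X`
  such that (a) each `b` factors as `X' → Xᵢ → X`, and (b) each of these morphisms `X' → Xᵢ` is
  a `bᵢ⁻¹(U)`-admissible blowup." Proof as printed: blow up the product `𝓘 = 𝓘₁ ⋯ 𝓘ₙ`; by
  blowing up in a product of ideals (Tag 080A, `IsBlowup.comp`) the blowing up of `Xᵢ` in
  `bᵢ⁻¹(∏_{j ≠ i} 𝓘ⱼ) 𝒪_{Xᵢ}` composed with `bᵢ` is a blowing up of `X` in `𝓘`, hence (uniqueness of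
  blowing ups) the blowing up `b` of `𝓘` factors through it. The quasi-compactness hypotheses
  of the printed statement are not needed for this argument and are dropped.

## References

* The Stacks Project, Tag 080N (`divisors-lemma-dominate-admissible-blowups`), Tag 080K,
  Tag 080A. [StacksProject]
* M. Raynaud, L. Gruson, *Critères de platitude et de projectivité*, Invent. Math. 13 (1971),
  Première partie, §5.1. [RaynaudGruson1971]
-/

noncomputable section

open CategoryTheory CategoryTheory.Limits AlgebraicGeometry TopologicalSpace Opposite

namespace Literature.AlgebraicGeometry.Resolution

universe u

open Literature.AlgebraicGeometry.Limits

/-! ## Pull-backs and finite products of ideal sheaves of finite type -/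

/-- The pull-back of an ideal sheaf along `f : X → Y` has finitely generated section ideals on
the affine opens `W ⊆ f⁻¹U`, `U ⊆ Y` affine with `𝓚(U)` finitely generated: over `W → U` the
pulled-back closed subscheme is `V(𝓚(U) Γ(X, W))`. [folklore] -/
theorem fg_ideal_comap_of_le {X Y : Scheme.{u}} (f : X ⟶ Y) (K : Y.IdealSheafData)
    (U : Y.affineOpens) (hKU : (K.ideal U).FG) (W : X.affineOpens)
    (hW : (W : X.Opens) ≤ f ⁻¹ᵁ (U : Y.Opens)) : ((K.comap f).ideal W).FG := by
  haveI : IsAffine (W : Scheme.{u}) := W.2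
  haveI : IsAffine (U : Scheme.{u}) := U.2
  have hc : (K.comap f).comap (W : X.Opens).ι =
      (K.comap (U : Y.Opens).ι).comap (f.resLE U W hW) := by
    rw [← Scheme.IdealSheafData.comap_comp, ← Scheme.IdealSheafData.comap_comp,
      Scheme.Hom.resLE_comp_ι]
  have hKU' : ∀ W' : Y.affineOpens, (W' : Y.Opens) ≤ U → (K.ideal W').FG := fun W' hW' => by
    rw [← K.map_ideal hW']
    exact hKU.map _
  -- finite generation at the top affine open of `W`
  have htop : (((K.comap f).comap (W : X.Opens).ι).ideal ⟨⊤, isAffineOpen_top _⟩).FG := by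
    rw [hc, ideal_comap_eq_map (f.resLE U W hW) (K.comap (U : Y.Opens).ι) ⟨⊤, isAffineOpen_top _⟩
      ⟨⊤, isAffineOpen_top _⟩ rfl]
    exact (fg_ideal_comap_ι hKU' _).map _
  refine fg_ideal_of_fg_ideal_comap_ι (U := (W : X.Opens)) (fun W'' => ?_) W le_rfl
  rw [← ((K.comap f).comap (W : X.Opens).ι).map_ideal
    (show (W'' : (W : Scheme.{u}).Opens) ≤
      ((⟨⊤, isAffineOpen_top _⟩ : (W : Scheme.{u}).affineOpens) : (W : Scheme.{u}).Opens) from le_top)]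
  exact htop.map _

/-- **The pull-back of an ideal sheaf of finite type is of finite type.** [folklore] -/
theorem fg_ideal_comap {X Y : Scheme.{u}} (f : X ⟶ Y) {K : Y.IdealSheafData}
    (hK : ∀ U : Y.affineOpens, (K.ideal U).FG) (V : X.affineOpens) : ((K.comap f).ideal V).FG := by
  refine fg_ideal_of_le_iSup (K.comap f)
    (fun q : {q : Y.affineOpens × X.affineOpens // (q.2 : X.Opens) ≤ f ⁻¹ᵁ (q.1 : Y.Opens)} =>
      (q.1.2 : X.Opens))
    (fun q W' hW' => fg_ideal_comap_of_le f K q.1.1 (hK _) W' (hW'.trans q.2)) V fun x _ => ?_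
  obtain ⟨U, hU, hxU, -⟩ :=
    exists_isAffineOpen_mem_and_subset (X := Y) (x := f x) (U := ⊤) (Opens.mem_top _)
  obtain ⟨W, hW, hxW, hWU⟩ :=
    exists_isAffineOpen_mem_and_subset (X := X) (x := x) (U := f ⁻¹ᵁ U) hxU
  exact Opens.mem_iSup.mpr ⟨⟨(⟨U, hU⟩, ⟨W, hW⟩), hWU⟩, hxW⟩

/-- Finite products of ideal sheaves of finite type are of finite type. [folklore] -/
theorem fg_ideal_finsetProd {X : Scheme.{u}} {ι : Type*} (s : Finset ι) (I : ι → X.IdealSheafData)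
    (hI : ∀ i ∈ s, ∀ W : X.affineOpens, ((I i).ideal W).FG) (W : X.affineOpens) :
    ((∏ i ∈ s, I i).ideal W).FG := by
  classical
  induction s using Finset.induction_on with
  | empty =>
    rw [Finset.prod_empty, Scheme.IdealSheafData.one_eq_top, Scheme.IdealSheafData.ideal_top]
    exact ⟨{1}, by simp⟩
  | insert a s ha ih =>
    rw [Finset.prod_insert ha, Scheme.IdealSheafData.ideal_mul, Pi.mul_apply]
    exact (hI a (Finset.mem_insert_self a s) W).mul
      (ih fun i hi => hI i (Finset.mem_insert_of_mem hi))

/-- The support of a finite product of ideal sheaves is the union of the supports. [folklore] -/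
theorem support_finsetProd {X : Scheme.{u}} {ι : Type*} (s : Finset ι) (I : ι → X.IdealSheafData) :
    ((∏ i ∈ s, I i).support : Set X) = ⋃ i ∈ s, ((I i).support : Set X) := by
  classical
  induction s using Finset.induction_on with
  | empty =>
    rw [Finset.prod_empty, Scheme.IdealSheafData.one_eq_top, Scheme.IdealSheafData.support_top]
    simp
  | insert a s ha ih =>
    rw [Finset.prod_insert ha, Scheme.IdealSheafData.support_mul]
    simp [ih]

/-! ## Dominating finitely many admissible blowing ups (Stacks 080N) -/

/-- **Stacks, Tag 080N (finitely many admissible blowing ups are dominated by one).** For an open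
`U ⊆ Y` and finitely many blowing ups `bᵢ : Xᵢ → Y` in ideal sheaves `𝓘ᵢ` of finite type with
support disjoint from `U` (`U`-admissible blowing ups), the blowing up `b : Y' → Y` in the
product `∏ 𝓘ᵢ` — of finite type, with support disjoint from `U` — factors through each `bᵢ` by a
morphism `gᵢ : Y' → Xᵢ` which is a blowing up of `Xᵢ` in the ideal sheaf
`bᵢ⁻¹(∏_{j ≠ i} 𝓘ⱼ) 𝒪_{Xᵢ}`, again of finite type and with support disjoint from `bᵢ⁻¹(U)` (a
`bᵢ⁻¹(U)`-admissible blowing up). Printed for `Y` quasi-compact quasi-separated and `U`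
quasi-compact; these hypotheses are not used. [cite: StacksProject, Tag 080N] -/
theorem IsBlowup.exists_isBlowup_prod_dominating {Y : Scheme.{u}} {ι : Type*} [Fintype ι]
    [DecidableEq ι] (U : Y.Opens) {X : ι → Scheme.{u}} (b : ∀ i, X i ⟶ Y)
    (I : ι → Y.IdealSheafData) (hb : ∀ i, IsBlowup (b i) (I i))
    (hI : ∀ i (W : Y.affineOpens), ((I i).ideal W).FG)
    (hIU : ∀ i, Disjoint (U : Set Y) ((I i).support : Set Y)) :
    ∃ (Y' : Scheme.{u}) (c : Y' ⟶ Y), IsBlowup c (∏ i, I i) ∧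
      (∀ W : Y.affineOpens, ((∏ i, I i).ideal W).FG) ∧
      Disjoint (U : Set Y) ((∏ i, I i).support : Set Y) ∧
      ∀ i, ∃ g : Y' ⟶ X i, g ≫ b i = c ∧
        IsBlowup g ((∏ j ∈ Finset.univ.erase i, I j).comap (b i)) ∧
        (∀ W : (X i).affineOpens, (((∏ j ∈ Finset.univ.erase i, I j).comap (b i)).ideal W).FG) ∧
        Disjoint ((b i ⁻¹ᵁ U : (X i).Opens) : Set (X i))
          (((∏ j ∈ Finset.univ.erase i, I j).comap (b i)).support : Set (X i)) := by
  obtain ⟨Y', c, hc⟩ := exists_isBlowup Y (∏ i, I i)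
  have hfg : ∀ W : Y.affineOpens, ((∏ i, I i).ideal W).FG :=
    fg_ideal_finsetProd _ I fun i _ => hI i
  have hdisj : ∀ (s : Finset ι), Disjoint (U : Set Y) ((∏ i ∈ s, I i).support : Set Y) := fun s => by
    rw [support_finsetProd]
    exact Set.disjoint_iUnion₂_right.mpr fun i _ => hIU i
  refine ⟨Y', c, hc, hfg, hdisj _, fun i => ?_⟩
  -- the blowing up of `X i` in `bᵢ⁻¹(∏_{j ≠ i} 𝓘ⱼ)`, composed with `bᵢ`, is a blowing up in `∏ 𝓘ⱼ`
  obtain ⟨Z, c', hc'⟩ := exists_isBlowup (X i) ((∏ j ∈ Finset.univ.erase i, I j).comap (b i))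
  have hcomp : IsBlowup (c' ≫ b i) (∏ j, I j) := by
    rw [← Finset.mul_prod_erase Finset.univ I (Finset.mem_univ i)]
    exact (hb i).comp hc'
  obtain ⟨e, he, -⟩ := hc.unique hcomp
  refine ⟨e.hom ≫ c', by rw [Category.assoc, he], hc'.iso_comp e,
    fg_ideal_comap (b i) (fg_ideal_finsetProd _ I fun j _ => hI j), ?_⟩
  rw [Scheme.IdealSheafData.support_comap]
  exact (hdisj _).preimage (b i)

end Literature.AlgebraicGeometry.Resolution

end
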